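import Literature.MathematicalPhysics.QuantumFieldTheory.Balaban1983to89.B9Eq326DeltaALocalityZd
import Literature.MathematicalPhysics.QuantumFieldTheory.Balaban1983to89.B9Thm311GaugeReductionZd

/-!
# `Balaban1983to89.B9Thm311PerMemberCubeZd` — [Balaban1985BackgroundPropagators] Thm 3.11 p. 416 («the operators … Δ_a, G are positive definite»; (3.27)
# `G = (Δ_a↾Ω₀)⁻¹`) AT ONE CUBE MEMBER OF [Balaban1985RegularSpaces] (1.131), FOR EVERY SMALL FIELD NEAR THE MEMBER — THE KNIT of the per-member road
# (IDEA-3.11): flat positivity (i) + continuity (ii) + gauge covariance (iii) + the gauge step and locality (iv) ⟹ `G_𝔤(U₀) = (□₀Δ_a(U₀)□₀)⁻¹` EXISTS on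
# `E_𝔤(□₀)` for the genuine four-letter `Δ_a(U₀)` of dag-n06-w4's record `opsAllZd` at print's class `cubeLamBP`, for EVERY unitary `U₀` whose plaquette
# variables are `α`-close to `1` on the box `□₀ ± 3` (`α > 0` depending on the member)

statement-level skeleton of published theorems with citation tags; proofs where landed; nothing here is a claim about the
Yang–Mills mass gap

`[Balaban1985BackgroundPropagators]` ("B9", CMP **99** (1985) 389–434) p. 416, verbatim: «Theorem 3.11. Under the assumptions of the Theorems 3.1–3.10
(i.e. for M sufficiently large and α₀ sufficiently small) the operators Δ′_a, G′, (Q′G′²Q′*)⁻¹, Δ_a, G are positive definite. … Let us take G(U) and let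
us consider the operators G_□(U). Doing the gauge transformation we get the configuration U = e^{iηA} with A small, and by (3.86) we get G_□(e^{iηA}) =
G_□(1)(I − V(A)G_□(1))⁻¹. In [4] we have proved that the operator G_□(1) is positive, hence by the same reasoning as above we prove positivity of G_□.»;
p. 395 (3.27) «G = (Δ_a↾Ω₀)⁻¹ … It will be proved later (Theorem 3.11)»; p. 396 (3.34)–(3.35).  `[Balaban1985RegularSpaces]` ("B8") (1.7) p. 77, (1.58)
p. 86, (1.131) p. 99.  `[Balaban1985Averaging]` ("B7") p. 24 l. −2 – p. 25 l. 2 (axial gauge).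

CITATION HEADER (lean-in-tree rule).  Cell `pub-ymgap` (YM-PLAN Track A, HUMAN RULING D-0062), DAG node N06 = [B9], seat `pub-ymgap-dag-n06-b` generation 19
(CLAIM-2 «IDEA-3.11 (iv)», INTENT-4 part A: the knit from DISPLAYED (B) «uniform ball» and (G) «orbit» hypotheses; the unconditional discharge of (B)(G) by
dag-n06-w4 g3's `B9Thm311PosDefNearFlatZd` + dag-n06-w2 g3's `B9Eq17RegimeBallZd` + dag-n06-w3 g3's `B9Eq334GaugeCovarianceZdHerm` is the companion file).

WHAT IS PROVED (kernel, 0 sorry, 0 def).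
* §1 `box3_le` · `plaqIn_box3_of_touches` (the plaquettes touching the `□_j` lie in `□₀ ± 3`).
* §2 ★★ `regularAtH_of_pdevOn_lt_cube_of` — from DISPLAYED (B) «uniform ball» and (G) «orbit» hypotheses: `∃ α > 0, ∀ unitary U₀, pdevOn (□₀±3) U₀ < α →
  RegularAtH …` (the schema `of_pdevOn_lt` + the locality `regular_opsAllZd_congr_cube`) · `regularAtH_and_reg17_of_pdevOn_lt_cube_of` (+ the (1.7) certificate,
  `reg17_of_pdevOn_lt_unitary`) · `gopZdH_deltaAOf_of_pdevOn_lt_cube_of` · `posDefH_of_pdevOn_lt_cube_of` (the form `⟨A, Δ_a A⟩_τ > 0` on `E_𝔤(□₀) ∖ 0`).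
* (companion `B9Thm311PerMemberCubeZdUnconditional`, once dag-n06-w3's `B9Eq334GaugeCovarianceZdHerm` is in the tree) the UNCONDITIONAL knit: (B) := dag-n06-w4's
  `regularAtH_eventually_one_cube_reg17UnivP` ∕ `bondPair_pos_eventually_one_cube_reg17UnivP` read on dag-n06-w2's uniform ball (`exists_uniform_ball_of_eventually_reg17UnivP`),
  (G) := dag-n06-w3's `regularAtH_opsAllZd_gaugeAct_iff` ∕ `posDefH_opsAllZd_gaugeAct` at the P₀ box clause `hbox0_cubeLamBP_of_eq`.

HONEST SCOPE ∕ A6.  PER MEMBER: the smallness `α` depends on the cube member (compactness + gauge kinematics), NOT print's uniform `α₀′`, `M₀` of Thm 3.11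
(which rest on Thm 3.3's decay and the partition (3.115)); the hypothesis is «plaquette variables `α`-close to `1` on the BOX `□₀ ± 3`» — a neighbourhood of
the member, slightly more than the level-`0` clause of the class `𝔄_m(α₀)` (plaquettes TOUCHING `□₀`; dag-n05-w3 g3's `of_touching_plaquettes` schema would
give that reading once the locality is re-keyed to `SideTouches`); no quantitative bound on `G_𝔤(U₀)` (Thm 3.3 is N06's object-bound); the binder `InvAtH` of the junction is NOT
inhabited by this file (its class guard is the frame's `Reg335`; see the bus census).  Non-vacuity: `U₀ = 1` satisfies the hypothesis at every member (`pdevOn …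
1 = 0`).  Count-neutral helper of K1⁷ (`--supports stmt-QuantumFields-20542`); N05∕N06 NOT discharged; one finite `𝕋⁴` programme at fixed `ε`, Bałaban as
printed; R4 closes only the conditional finite-`𝕋⁴` rung `BalabanLadder.UV` — nothing continuum ∕ `ℝ⁴` ∕ OS ∕ mass gap ∕ Clay.  Unit `pub-ymgap-dag-n06-b`
(g19), 2026-08-28.
-/

noncomputable section

open scoped BigOperators

namespace Literature.MathematicalPhysics.QuantumFieldTheory.Balaban1983to89.B9Thm311PerMemberCubeZd

open B7Prop1Explicit (e gaugeAct)
open B7Prop1Local (InBox AgreeOn PlaqIn pdevOn)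
open B7Prop2Explicit (unitaryUnits unitaryUnits_le_U1)
open B8Ineq132 (PlaqTouches BondTouches)
open B8Eq131Cubes (cube sqLo sqHi cube_anti)
open B8Eq131CubesAdmissible (cubeFam cubeFam_false_of_le)
open B8CubeMemberZd (cubeLamS)
open B8Ineq159FlatCubeMemberPrinted (cubeLamBP)
open B8LeafModelZd (ZdIdx)
open B9SupplySockB9P3ZdLetters (OpsZd deltaAOf)
open B9Eq327GreenZd (domSub bondPair)
open B9Eq327GreenZdHerm (domSubH RegularAtH gopZdH gopZdH_apply_eq_of_regularAtH domSubH_le)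
open B9SupplySockB9P3ZdAllLettersZd (opsAllZd)
open B9Eq316AveragingTransposeZd (Reg17 alphaQ alphaQ_pos)
open B9Eq326DeltaALocalityZd (regular_opsAllZd_congr_cube)
open B9Thm311GaugeReductionZd (of_pdevOn_lt reg17_of_pdevOn_lt_unitary)

export B7Prop1Explicit (Site)

variable {d : ℕ} {𝔸 : Type*} [CStarAlgebra 𝔸] [Nontrivial 𝔸]

/-! ## §1 The cube member's box `□₀ ± 3` -/

section Box

omit [CStarAlgebra 𝔸] [Nontrivial 𝔸] in
/-- the box `[sqLo₀ − 3·𝟙, sqHi₀ + 3·𝟙]` around `□₀` is a genuine box. [cite: Balaban1985RegularSpaces, (1.131) p.99] -/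
theorem box3_le (L : ℕ) (a : Site d) (Mc ρ k : ℕ) : ∀ i', sqLo L a ρ k 0 i' - 3 ≤ sqHi L a Mc ρ k 0 i' + 3 := by
  intro i'
  simp only [sqLo, sqHi, B8Eq131Cubes.bLo, B8Eq131Cubes.bHi]
  have h1 : (0 : ℤ) ≤ (L : ℤ) ^ (k - 0) * (Mc : ℤ) := by positivity
  have h2 : (0 : ℤ) ≤ ((ρ * B8Eq131Cubes.gs L (k - 0) : ℕ) : ℤ) := by positivity
  nlinarith

omit [CStarAlgebra 𝔸] [Nontrivial 𝔸] in
/-- every plaquette touching some `□_j` (`j ≤ m ≤ k`) lies in the box `□₀ ± 3` (indeed in `□₀ ± 1`). [cite: Balaban1985RegularSpaces, p.77 (plaquette convention), (1.131) p.99] -/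
theorem plaqIn_box3_of_touches {L : ℕ} (i : ZdIdx d L) {a : Site d} {Mc ρ : ℕ} (hΩ : i.Ω = cubeFam false L a Mc ρ i.k) {m : ℕ} (hm : m ≤ i.k) :
    ∀ j, j ≤ m → ∀ (x : Site d) (μ ν : Fin d), μ ≠ ν → PlaqTouches (i.Ω j) x μ ν →
      PlaqIn (fun i' => sqLo L a ρ i.k 0 i' - 3) (fun i' => sqHi L a Mc ρ i.k 0 i' + 3) (x, μ, ν) := by
  intro j hj x μ ν hμν hp
  have hsub : i.Ω j ⊆ cube L a Mc ρ i.k 0 := by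
    rw [hΩ, cubeFam_false_of_le L a Mc ρ (hj.trans hm)]; exact cube_anti (Nat.zero_le j) (hj.trans hm)
  have hin : ∀ {z : Site d}, z ∈ i.Ω j → ∀ i', sqLo L a ρ i.k 0 i' ≤ z i' ∧ z i' ≤ sqHi L a Mc ρ i.k 0 i' :=
    fun hz i' => (B8Ineq159FlatCubeMemberKernel.mem_cube_zero_iff L a Mc ρ i.k _).1 (hsub hz) i'
  have he : ∀ (κ : Fin d) (i' : Fin d), 0 ≤ (e κ : Site d) i' ∧ (e κ : Site d) i' ≤ 1 := fun κ i' => by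
    rw [B7Prop1Explicit.e_apply]; split_ifs <;> simp
  -- the base `x` lies within two of `□₀`
  have hx : ∀ i', sqLo L a ρ i.k 0 i' - 2 ≤ x i' ∧ x i' ≤ sqHi L a Mc ρ i.k 0 i' + 1 := by
    intro i'
    rcases hp with h | h | h | h
    · have := hin h i'; constructor <;> linarith [this.1, this.2]
    · have := hin h i'; simp only [Pi.add_apply] at this
      constructor <;> linarith [this.1, this.2, (he μ i').1, (he μ i').2]
    · have := hin h i'; simp only [Pi.add_apply] at this
      constructor <;> linarith [this.1, this.2, (he ν i').1, (he ν i').2]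
    · have := hin h i'; simp only [Pi.add_apply] at this
      constructor <;> linarith [this.1, this.2, (he μ i').1, (he μ i').2, (he ν i').1, (he ν i').2]
  refine ⟨fun i' => ⟨by linarith [(hx i').1], by linarith [(hx i').2]⟩, fun i' => ?_⟩
  simp only [Pi.add_apply]
  constructor <;> linarith [(hx i').1, (hx i').2, (he μ i').1, (he μ i').2, (he ν i').1, (he ν i').2]

end Box

/-! ## §2 The knit: uniform ball + orbit invariance ⟹ regularity at every background with small plaquettes on `□₀ ± 3` -/

section Knit

variable (τ : 𝔸 →ₗ[ℂ] ℂ) [FiniteDimensional ℝ 𝔸] {L : ℕ}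

/-- ★★ **[B9] THM 3.11 AT ONE CUBE MEMBER FROM (B) AND (G)**: at a cube member (`Ω = cubeFam false …`, `Λs = cubeLamS …`, class `cubeLamBP`, `m ≤ k`,
`2 ≤ L ≤ ρ`, `Ω₀` finite), if the genuine four-letter record is regular on `E_𝔤(□₀)` (B) at every unitary background uniformly `δ`-close to `1`, and (G)
regularity passes from `U^u` to `U` for unitary gauge functions, then THERE IS `α > 0` such that EVERY unitary background whose plaquette variables are
`α`-close to `1` on the box `□₀ ± 3` is regular: `G_𝔤(U₀) = (□₀Δ_a(U₀)□₀)⁻¹` exists — the locality input (L) is this seat's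
`B9Eq326DeltaALocalityZd.regular_opsAllZd_congr_cube`, the mechanism `B9Thm311GaugeReductionZd.of_pdevOn_lt`.
[cite: Balaban1985BackgroundPropagators, Thm 3.11 p.416 (proof: «doing the gauge transformation we get the configuration U = e^{iηA} with A small»), (3.27) p.395, (3.34) p.396] -/
theorem regularAtH_of_pdevOn_lt_cube_of (hL : 2 ≤ L) (ops₀ : ℝ → ZdIdx d L → ℕ → OpsZd d 𝔸) (M : ℝ) (i : ZdIdx d L)
    {a : Site d} {Mc ρ : ℕ} (hρ : L ≤ ρ) (hΩ : i.Ω = cubeFam false L a Mc ρ i.k) (hΛs : i.Λs = cubeLamS L a Mc ρ i.k)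
    (hfin : (i.Ω 0).Finite) {m : ℕ} (hm : m ≤ i.k)
    (hball : ∃ δ : ℝ, 0 < δ ∧ ∀ U : Site d → Fin d → 𝔸ˣ, (∀ x κ, U x κ ∈ unitaryUnits 𝔸) →
      (∀ x κ, ‖((U x κ : 𝔸ˣ) : 𝔸) - 1‖ < δ) → RegularAtH i.η (opsAllZd τ L (cubeLamBP L a Mc ρ i.k) ops₀ M i m) (i.Ω 0) U)
    (hcov : ∀ (u : Site d → 𝔸ˣ) (U : Site d → Fin d → 𝔸ˣ), (∀ x, u x ∈ unitaryUnits 𝔸) → (∀ x κ, U x κ ∈ unitaryUnits 𝔸) →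
      RegularAtH i.η (opsAllZd τ L (cubeLamBP L a Mc ρ i.k) ops₀ M i m) (i.Ω 0) (gaugeAct u U) →
        RegularAtH i.η (opsAllZd τ L (cubeLamBP L a Mc ρ i.k) ops₀ M i m) (i.Ω 0) U) :
    ∃ α : ℝ, 0 < α ∧ ∀ U₀ : Site d → Fin d → 𝔸ˣ, (∀ x κ, U₀ x κ ∈ unitaryUnits 𝔸) →
      pdevOn (fun i' => sqLo L a ρ i.k 0 i' - 3) (fun i' => sqHi L a Mc ρ i.k 0 i' + 3) U₀ < α →
        RegularAtH i.η (opsAllZd τ L (cubeLamBP L a Mc ρ i.k) ops₀ M i m) (i.Ω 0) U₀ :=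
  of_pdevOn_lt (box3_le L a Mc ρ i.k) hball hcov fun _ _ _ _ hag hP =>
    ((regular_opsAllZd_congr_cube τ hL ops₀ M i hρ hΩ hΛs hfin hm hag).1).mp hP

/-- ★★ **THE SAME WITH THE GENUINENESS CERTIFICATE**: shrinking `α` below `(α_Q∕L²)·L^{−2m}` the backgrounds concerned also lie in print's class (1.7)
`Reg17 L m i.Ω (α_Q∕L²)` of the member, where the averaging letter `Q*aQ` of the record IS print's operator (`QQZdP_of_reg17`) — so the regularity is
about the genuine `Δ_a(U₀)`, not about the letter's `0` branch. [cite: Balaban1985BackgroundPropagators, Thm 3.11 p.416, (3.16) p.393; Balaban1985RegularSpaces, (1.7) p.77] -/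
theorem regularAtH_and_reg17_of_pdevOn_lt_cube_of (hL : 2 ≤ L) (ops₀ : ℝ → ZdIdx d L → ℕ → OpsZd d 𝔸) (M : ℝ) (i : ZdIdx d L)
    {a : Site d} {Mc ρ : ℕ} (hρ : L ≤ ρ) (hΩ : i.Ω = cubeFam false L a Mc ρ i.k) (hΛs : i.Λs = cubeLamS L a Mc ρ i.k)
    (hfin : (i.Ω 0).Finite) {m : ℕ} (hm : m ≤ i.k)
    (hball : ∃ δ : ℝ, 0 < δ ∧ ∀ U : Site d → Fin d → 𝔸ˣ, (∀ x κ, U x κ ∈ unitaryUnits 𝔸) →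
      (∀ x κ, ‖((U x κ : 𝔸ˣ) : 𝔸) - 1‖ < δ) → RegularAtH i.η (opsAllZd τ L (cubeLamBP L a Mc ρ i.k) ops₀ M i m) (i.Ω 0) U)
    (hcov : ∀ (u : Site d → 𝔸ˣ) (U : Site d → Fin d → 𝔸ˣ), (∀ x, u x ∈ unitaryUnits 𝔸) → (∀ x κ, U x κ ∈ unitaryUnits 𝔸) →
      RegularAtH i.η (opsAllZd τ L (cubeLamBP L a Mc ρ i.k) ops₀ M i m) (i.Ω 0) (gaugeAct u U) →
        RegularAtH i.η (opsAllZd τ L (cubeLamBP L a Mc ρ i.k) ops₀ M i m) (i.Ω 0) U) :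
    ∃ α : ℝ, 0 < α ∧ ∀ U₀ : Site d → Fin d → 𝔸ˣ, (∀ x κ, U₀ x κ ∈ unitaryUnits 𝔸) →
      pdevOn (fun i' => sqLo L a ρ i.k 0 i' - 3) (fun i' => sqHi L a Mc ρ i.k 0 i' + 3) U₀ < α →
        RegularAtH i.η (opsAllZd τ L (cubeLamBP L a Mc ρ i.k) ops₀ M i m) (i.Ω 0) U₀ ∧
          Reg17 L m i.Ω (alphaQ d L / (L : ℝ) ^ 2) U₀ := by
  have hL1 : 1 ≤ L := le_trans (by norm_num) hL
  have hL0 : (0 : ℝ) < L := by exact_mod_cast (lt_of_lt_of_le (by norm_num) hL)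
  obtain ⟨α, hα, hreg⟩ := regularAtH_of_pdevOn_lt_cube_of τ hL ops₀ M i hρ hΩ hΛs hfin hm hball hcov
  set β : ℝ := alphaQ d L / (L : ℝ) ^ 2 * (((L : ℝ) ^ m)⁻¹) ^ 2 with hβ
  have hβ0 : 0 < β := by have := alphaQ_pos d hL1; positivity
  refine ⟨min α β, lt_min hα hβ0, fun U₀ hU₀ hsmall => ⟨hreg U₀ hU₀ (hsmall.trans_le (min_le_left _ _)), ?_⟩⟩
  exact reg17_of_pdevOn_lt_unitary hL1 (plaqIn_box3_of_touches i hΩ hm) hU₀ (by have := alphaQ_pos d hL1; positivity)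
    (hsmall.trans_le (min_le_right _ _))

/-- ★★ **(3.27) AT EVERY SUCH BACKGROUND, AS [Balaban1985RegularSpaces] (1.58) USES IT**: `G_𝔤(U₀)J = A` for every Hermitian `A ∈ E(□₀)` and every `J`
agreeing with `Δ_a(U₀)A` on the bonds of `□₀` (from (B), (G) as above). [cite: Balaban1985BackgroundPropagators, (3.27) p.395, Thm 3.11 p.416; Balaban1985RegularSpaces, (1.58) p.86] -/
theorem gopZdH_deltaAOf_of_pdevOn_lt_cube_of (hL : 2 ≤ L) (ops₀ : ℝ → ZdIdx d L → ℕ → OpsZd d 𝔸) (M : ℝ) (i : ZdIdx d L)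
    {a : Site d} {Mc ρ : ℕ} (hρ : L ≤ ρ) (hΩ : i.Ω = cubeFam false L a Mc ρ i.k) (hΛs : i.Λs = cubeLamS L a Mc ρ i.k)
    (hfin : (i.Ω 0).Finite) {m : ℕ} (hm : m ≤ i.k)
    (hball : ∃ δ : ℝ, 0 < δ ∧ ∀ U : Site d → Fin d → 𝔸ˣ, (∀ x κ, U x κ ∈ unitaryUnits 𝔸) →
      (∀ x κ, ‖((U x κ : 𝔸ˣ) : 𝔸) - 1‖ < δ) → RegularAtH i.η (opsAllZd τ L (cubeLamBP L a Mc ρ i.k) ops₀ M i m) (i.Ω 0) U)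
    (hcov : ∀ (u : Site d → 𝔸ˣ) (U : Site d → Fin d → 𝔸ˣ), (∀ x, u x ∈ unitaryUnits 𝔸) → (∀ x κ, U x κ ∈ unitaryUnits 𝔸) →
      RegularAtH i.η (opsAllZd τ L (cubeLamBP L a Mc ρ i.k) ops₀ M i m) (i.Ω 0) (gaugeAct u U) →
        RegularAtH i.η (opsAllZd τ L (cubeLamBP L a Mc ρ i.k) ops₀ M i m) (i.Ω 0) U) :
    ∃ α : ℝ, 0 < α ∧ ∀ U₀ : Site d → Fin d → 𝔸ˣ, (∀ x κ, U₀ x κ ∈ unitaryUnits 𝔸) →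
      pdevOn (fun i' => sqLo L a ρ i.k 0 i' - 3) (fun i' => sqHi L a Mc ρ i.k 0 i' + 3) U₀ < α →
        ∀ A ∈ domSubH (𝔸 := 𝔸) (i.Ω 0), ∀ J : Site d → Fin d → 𝔸,
          (∀ (y : Site d) (μ : Fin d), BondTouches (i.Ω 0) y μ → J y μ = deltaAOf i.η (opsAllZd τ L (cubeLamBP L a Mc ρ i.k) ops₀ M i m) U₀ A y μ) →
          gopZdH i.η (opsAllZd τ L (cubeLamBP L a Mc ρ i.k) ops₀ M i m) (i.Ω 0) U₀ J = A := by
  obtain ⟨α, hα, hreg⟩ := regularAtH_of_pdevOn_lt_cube_of τ hL ops₀ M i hρ hΩ hΛs hfin hm hball hcov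
  exact ⟨α, hα, fun U₀ hU₀ hsmall A hA J hJ => gopZdH_apply_eq_of_regularAtH i.η _ (i.Ω 0) U₀ (hreg U₀ hU₀ hsmall) hA hJ⟩

/-- ★★ **POSITIVITY VERSION, FROM DISPLAYED (B) AND (G)**: if `⟨A, Δ_a(U)A⟩_τ > 0` on `E_𝔤(□₀) ∖ 0` at every unitary background uniformly `δ`-close to `1`, and this
positivity passes from `U^u` to `U`, then it holds at EVERY unitary background with plaquettes `α`-close to `1` on `□₀ ± 3` — print's «positive definite» of
Thm 3.11 at the member; locality = the pairing conjunct of `regular_opsAllZd_congr_cube`. [cite: Balaban1985BackgroundPropagators, Thm 3.11 p.416, (3.34) p.396] -/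
theorem posDefH_of_pdevOn_lt_cube_of (hL : 2 ≤ L) (ops₀ : ℝ → ZdIdx d L → ℕ → OpsZd d 𝔸) (M : ℝ) (i : ZdIdx d L)
    {a : Site d} {Mc ρ : ℕ} (hρ : L ≤ ρ) (hΩ : i.Ω = cubeFam false L a Mc ρ i.k) (hΛs : i.Λs = cubeLamS L a Mc ρ i.k)
    (hfin : (i.Ω 0).Finite) {m : ℕ} (hm : m ≤ i.k)
    (hball : ∃ δ : ℝ, 0 < δ ∧ ∀ U : Site d → Fin d → 𝔸ˣ, (∀ x κ, U x κ ∈ unitaryUnits 𝔸) →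
      (∀ x κ, ‖((U x κ : 𝔸ˣ) : 𝔸) - 1‖ < δ) →
        ∀ A ∈ domSubH (𝔸 := 𝔸) (i.Ω 0), A ≠ 0 → 0 < bondPair τ A (deltaAOf i.η (opsAllZd τ L (cubeLamBP L a Mc ρ i.k) ops₀ M i m) U A))
    (hcov : ∀ (u : Site d → 𝔸ˣ) (U : Site d → Fin d → 𝔸ˣ), (∀ x, u x ∈ unitaryUnits 𝔸) → (∀ x κ, U x κ ∈ unitaryUnits 𝔸) →
      (∀ A ∈ domSubH (𝔸 := 𝔸) (i.Ω 0), A ≠ 0 → 0 < bondPair τ A (deltaAOf i.η (opsAllZd τ L (cubeLamBP L a Mc ρ i.k) ops₀ M i m) (gaugeAct u U) A)) →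
        ∀ A ∈ domSubH (𝔸 := 𝔸) (i.Ω 0), A ≠ 0 → 0 < bondPair τ A (deltaAOf i.η (opsAllZd τ L (cubeLamBP L a Mc ρ i.k) ops₀ M i m) U A)) :
    ∃ α : ℝ, 0 < α ∧ ∀ U₀ : Site d → Fin d → 𝔸ˣ, (∀ x κ, U₀ x κ ∈ unitaryUnits 𝔸) →
      pdevOn (fun i' => sqLo L a ρ i.k 0 i' - 3) (fun i' => sqHi L a Mc ρ i.k 0 i' + 3) U₀ < α →
        ∀ A ∈ domSubH (𝔸 := 𝔸) (i.Ω 0), A ≠ 0 → 0 < bondPair τ A (deltaAOf i.η (opsAllZd τ L (cubeLamBP L a Mc ρ i.k) ops₀ M i m) U₀ A) :=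
  of_pdevOn_lt (P := fun U => ∀ A ∈ domSubH (𝔸 := 𝔸) (i.Ω 0), A ≠ 0 →
      0 < bondPair τ A (deltaAOf i.η (opsAllZd τ L (cubeLamBP L a Mc ρ i.k) ops₀ M i m) U A))
    (box3_le L a Mc ρ i.k) hball hcov fun _ _ _ _ hag hP A hA hA0 => by
      rw [← (regular_opsAllZd_congr_cube τ hL ops₀ M i hρ hΩ hΛs hfin hm hag).2.2.2 A (domSubH_le _ hA)]
      exact hP A hA hA0

end Knit



end Literature.MathematicalPhysics.QuantumFieldTheory.Balaban1983to89.B9Thm311PerMemberCubeZd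

end
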